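import Summits.NavierStokesRegularity.NavierStokesRegularity.Theses.ConeTipCollapse

/-!
# Birth skeleton (BC3) for crux `ConeTipCollapse.InteractingLogPeriodicCone` (stmt-NavierStokesRegularity-19062)

planner-skel-stmt-NavierStokesRegularity-19062-0 · skeleton-register (BC3, one-shot; route re-audit bin
HONEST) · 2026-08-17. Route `route-NavierStokesRegularity-ConeTipCollapse` (rev 0; REFUTATION route,
`closes : InteractingLogPeriodicCone → ConeToResolver → SkeletonRealisation → ClayUniqueness →
¬ NavierStokesRegularity`), crux #3 (rank 3, OPEN, difficulty XL), "the wall":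

**AN INTERACTING LOG-PERIODIC STEADY EULER CONE EXISTS** — there are `1 < a < 3/2`, `l₀ > 1` and a
`C¹` pair `(h, P)` on `ℝ³ ∖ {0}` with `h(l₀ x) = l₀^{-a} h(x)`, `P(l₀ x) = l₀^{-2a} P(x)`
(discrete self-similarity = log-periodicity in `s = log |x|`), `div h = 0`, `(h·∇)h + ∇P = 0` off the
origin, equivariant under the 24 rotations of the cube (chiral octahedral group `O`:
`IsOctahedralIsometry g ∧ det g = 1`), and INTERACTING (`h` vanishes identically on no non-empty open
set — the clause that excludes the Gavrilov-type witnesses: dilated, `O`-symmetrised copies of a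
compactly supported steady Euler flow with disjoint supports form a non-trivial but non-interacting
`C^∞` DSS cone of EVERY degree).

## The line — ENERGY-CRITICAL CONE · CONTINUATION IN THE EXPONENT (the route's own TWO-LAYER PLAN)

The route header files the intended proof of this crux as "InteractingLogPeriodicCone ⇐
stub_variational (the `a = 3/2` energy-critical cone by equivariant relaxation on `S²×S¹`) →
stub_continuation (continuation in `a` into `(1,3/2)`, CAP)". This skeleton TYPES that plan over the
tree's declarations: each stub statement is the named proposition `Statement.<stub name>` (same
short name as the registered stub theorem, so that the hypotheses of
`InteractingLogPeriodicCone_of` are the stubs BY NAME for the skeleton audit; all clauses are written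
out verbatim in the shape of the route decl and only tree declarations occur inside them), and it
sharpens the earlier attached arrow-form `stub_continuation : CriticalCone →
InteractingLogPeriodicCone` into a genuine LOCAL CONTINUATION statement (`∀` critical cone,
`∀ ε > 0`, an admissible cone with `3/2 − ε < a < 3/2`), which neither restates the crux nor follows
from it.

* S1 `stub_variational` — THE ENERGY-CRITICAL CONE (`a = 3/2`; OPEN, the bet of the line): some
  `l₀ > 1` carries a `C¹`, `O`-equivariant, interacting steady Euler pair on `ℝ³ ∖ {0}` which is
  `l₀`-discretely self-similar of degrees `(−3/2, −3)`.
* S2 `stub_continuation` — CONTINUATION IN THE EXPONENT (OPEN, perturbative): every such critical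
  cone continues to exponents just below `3/2`: for every `ε > 0` there is an admissible cone
  (`C¹`, DSS of degrees `(−a, −2a)` for SOME ratio `l₁ > 1`, `O`-equivariant, interacting) with
  `3/2 − ε < a < 3/2`.

Composition `InteractingLogPeriodicCone_of : S1 → S2 → InteractingLogPeriodicCone` (proved below,
pure logic): take the critical cone of S1, continue it with `ε = 1/2`, and `3/2 − 1/2 < a` is `1 < a`.

## Why `a = 3/2`, why each stub is plausible, and what it leans on

* WHY THE CRITICAL EXPONENT (the lever of S1). For `h` DSS of degree `−a` with ratio `l₀`, the
  kinetic energy of the fundamental shell `A_r = {r ≤ |x| < l₀ r}` scales as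
  `E(A_{l₀ r}) = l₀^{3−2a} E(A_r)`: the density `|h|² dx` is dilation-INVARIANT iff `a = 3/2`. Then
  `E` descends to the compact quotient `M = (ℝ³ ∖ 0)/(x ∼ l₀ x) ≅ S² × ℝ/(log l₀)ℤ`, and for an
  equivariant volume-preserving rearrangement `h ↦ φ_* h` (`φ ∘ D = D ∘ φ`, `D x = l₀ x`, generated
  by a divergence-free `w` with `w(l₀ x) = l₀ w(x)`) the first variation is
  `δE = ∫_{A_1} w · (h × curl h) dx + (Φ_{l₀} − Φ_1)`, boundary fluxes through `|x| = l₀` and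
  `|x| = 1` of a density of degree `1 − 2a` — they CANCEL exactly when `l₀^{3−2a} = 1`, i.e. at
  `a = 3/2` and at no other exponent. So at `a = 3/2` (and only there) Arnold's variational
  principle / Moffatt's magnetic relaxation is available on the compact quotient with the
  `O × ⟨D⟩`-equivariance imposed: critical points of `E` on an equivariant `SDiff`-orbit satisfy
  `h × curl h = ∇π` with `π` DSS of degree `−3 = −2a`, i.e. they are exactly the cones of S1
  (`P = −π − |h|²/2` up to sign conventions). ENGINE: Voigt–MHD relaxation — Constantin–Pasqualotto,
  arXiv:2208.11109, Thm 1.1 [corpus:arxiv-2208.11109 p.4]: on `T³` the regularised flow relaxes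
  (subsequence, strongly in `H^γ`, `γ < α`) to a strong `L²` stationary Euler field
  `B_∞ ∈ D((−Δ)^{α/2})`, non-trivial whenever the (modified) helicity of the datum is non-zero —
  to be transplanted to `M` (equivariance of data is propagated by uniqueness of the regularised
  evolution). Nearest existence results: Abe, arXiv:2305.05987 (homogeneous, axisymmetric, degrees
  `−α ∉ [−2, 0]`, mountain-pass / linking on `S²`), who records "the existence of rotational
  asymmetric homogeneous solutions to (1.1) is unknown" [corpus:arxiv-2305.05987 p.12]; the
  irrotational `O`-equivariant point sink `−x/|x|³` is an admissible interacting cone at the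
  INTEGER exponent `a = 2` only (Shvydkoy, arXiv:1510.03378 §2: irrotational cones live at
  `α ∈ ℤ ∖ {1}`). WHY S1 MIGHT FAIL: (i) relaxation delivers `H^α`/weak limits, not `C¹`, and
  nothing makes the limit INTERACTING (it may relax onto a Gavrilov-type non-interacting pattern or
  lose regularity at separatrices); (ii) helicity `∫ A·B dx` is dilation-invariant at `a = 1`, not
  at `a = 3/2`, so the lower bound keeping the relaxed energy away from `0` must come from a
  weighted/quotient helicity or a linking invariant on `M` (route header, NOT DECOMPOSED YET);
  (iii) rigidity: Shvydkoy conjectures NO `C¹` homogeneous solutions for `α > −1` beyond the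
  irrotational integer family [corpus:arxiv-1510.03378 p.4] and proves none axisymmetric for
  `0 < α < 2` (Prop. 5.1 = `Literature.Analysis.FluidPDE.shvydkoy2018_prop51_noAxisymmetric`); the
  DSS class is wider (log-periodic Fourier modes in `s`) and `O`-equivariance is chosen so that the
  two scale-invariant conserved fluxes at `a = 3/2` (angular momentum flux through spheres) vanish
  by symmetry rather than by an identity, while the exact virial identity of the critical exponent,
  `∫_{A_1} (|h|² + 3P) dx = 0` (mean pressure `= −⅓` mean `|h|²`), is a constraint every candidate
  must meet, not a contradiction. Leans on (statement level only): `ContDiffOn`, `gradient`,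
  `Literature.Analysis.FluidPDE.convect`, `Literature.Analysis.FluidPDE.VectorCalculus.divergence`,
  `Literature.Analysis.FluidPDE.IsOctahedralIsometry` — exactly the crux's vocabulary.
  [arXiv:2208.11109 Thm 1.1; arXiv:2305.05987 p.12, §3; arXiv:1510.03378 p.4, Prop. 5.1;
  ArnoldKhesin1998 Ch. II–III; Moffatt 1985 (J. Fluid Mech. 159)]
* WHY CONTINUATION (the lever of S2). In `s = log |x|`, `σ = x/|x|` the cone system is a first-order
  system on the compact manifold `M` in which the exponent enters only through ZEROTH-ORDER terms
  (Euler's relations `Dh(x)x = −a h(x)`, `DP(x)x = −2a P(x)`; tree: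
  `IsHomogeneousSteadyEuler.fderiv_velocity_apply_self` for the homogeneous case), so the reduced
  operator `F(a, l, h, P)` depends analytically on `(a, l)`. Its linearisation at a critical cone
  always contains the two FORCED kernel directions — amplitude `h ↦ μ h, P ↦ μ² P` (Euler is
  quadratic) and dilation phase `(x·∇)h + a h` (a dilate of a DSS cone is a DSS cone with the same
  ratio) — and continuous rotations are excluded by `O`-equivariance. If these exhaust the kernel and
  the cokernel has the matching dimension (NON-DEGENERACY modulo symmetries), the implicit function
  theorem in `O`-equivariant `C^{1,β}` spaces on `M`, with the amplitude normalised and the period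
  `log l₁` freed as an unfolding parameter, gives a continuous branch `a ↦ (h_a, P_a, l_a)` through
  `a = 3/2`, on BOTH sides; `O`-equivariance persists by IFT-uniqueness and `C¹` by construction.
  The route names CAP (rigorous-numerics continuation: radii polynomials / Newton–Kantorovich on a
  Fourier(`s`) × spherical-harmonics(`σ`) Galerkin basis adapted to `O`) as the technique that
  certifies non-degeneracy and the interaction clause along the branch. WHY S2 MIGHT FAIL: (i) a
  degenerate critical cone (variational critical points come in families; the loss of the invariant
  energy for `a ≠ 3/2` reappears as the solvability condition `∂_a[(l^{3−2a} − 1) Φ_1] ≠ 0` at the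
  bifurcation exponent), (ii) a fold at `a = 3/2` with the branch existing only for `a ≥ 3/2`
  (S2 asks for `a < 3/2` specifically — the finite-local-energy side the route needs:
  `∫_{B_1} |h|² < ∞ ⇔ a < 3/2`), (iii) INTERACTION is not an open condition in `C¹` (a branch may
  develop an open zero set at a degenerate zero of `h`), so it has to be certified, not inherited.
  Precedents for perturbative 3-D steady Euler constructions near a given flow: Alber 1992 (Math.
  Ann. 292; flows with non-vanishing vorticity near a base flow whose streamlines cross the domain),
  Choffrut–Šverák 2012 (Geom. Funct. Anal. 22, 136–201: local structure of 2-D steady states near non-degenerate ones);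
  none covers cones. [ChoffrutSverak2012; Alber1992; arXiv:2305.05987 §3 (variational degeneracies);
  route header TWO-LAYER PLAN / NUMBERS]

## Disproof used / negatives / dead lines

No `Disproof.lean`, no `Negative/` lemma, no crux idea and no earlier LINE file exist for this crux
(`ledger crux ls stmt-NavierStokesRegularity-19062`: "no workfiles yet", 2026-08-17) — there is no
`_false_without_<H>` obligation to honour. The opening planner's attached (not filed) skeleton
registered `stub_variational : CriticalCone`, `stub_continuation : CriticalCone →
InteractingLogPeriodicCone` (evidence `InteractingLogPeriodicCone_birth.lean`, 2026-08-17T18:25Z);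
this file supersedes it with the same stub NAMES, statements written out over tree declarations
(`Statement.stub_variational`, `Statement.stub_continuation`) and a non-arrow S2.
Negatives index (`ledger negatives --problem NavierStokesRegularity`): the refuted
`AdiabaticEddy.CorrectorSolvable` (stmt-1429: compact support × diffusion, Carleman/UCP) is the
reason the crux — and both stubs — carry the INTERACTING clause instead of compact support; no stub
restates a refuted statement (none concerns steady Euler cones). The INTERACTING and `O`-clauses
travel verbatim through S1 → S2 → crux; the composition never weakens them.

## BC3 audit (registrar, 2026-08-17; raw outputs in the registrar's NOTES.md / bc/ folder)

See `Lines/birth.md` next to this file: `lean check --json` rc 0 with sorries = 2 = the two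
`stub_*` theorems (zero elsewhere; `InteractingLogPeriodicCone_of` closed); probes importing ONLY the
route file and stating each stub proposition written out (the text of `Statement.stub_*`), one
tactic per `example` (`exact?` · `simpa` · `simpa [defs]` · `aesop` · `intro; exact?` …):
`S → InteractingLogPeriodicCone`, `S → NavierStokesRegularity` and `S → ¬ NavierStokesRegularity`
all FAIL for S ∈ {S1, S2} (48/48).
-/

noncomputable section

set_option linter.dupNamespace false

namespace Summit.NavierStokesRegularity.NavierStokesRegularity.Cruxes.InteractingLogPeriodicCone.Birth

open Summit.NavierStokesRegularity.NavierStokesRegularity.Theses.ConeTipCollapse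

/-! ## The stub statements

Each stub's statement is the named proposition `Statement.<stub name>` (same short name as the
registered stub theorem, so that the hypotheses of `InteractingLogPeriodicCone_of` are the stubs BY
NAME for the skeleton audit `#h21_check_skeleton`); only tree declarations occur inside them. -/

namespace Statement

/-- **S1 `stub_variational` — THE ENERGY-CRITICAL CONE (`a = 3/2`).** There are a ratio `l₀ > 1`
and a pair `(h, P)`, `C¹` on `ℝ³ ∖ {0}`, with `h(l₀ x) = l₀^{-3/2} h(x)`, `P(l₀ x) = l₀^{-3} P(x)`,
`div h = 0` and `(h·∇)h + ∇P = 0` off the origin, equivariant under the 24 cube rotations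
(`h(g x) = g h(x)`, `P(g x) = P(x)`), and interacting (every non-empty open set contains `x ≠ 0`
with `h x ≠ 0`). Size: open problem (the existence bet of the line). WHY PLAUSIBLE: `a = 3/2` is the
unique exponent at which `|h|² dx` is dilation-invariant, so kinetic energy descends to the compact
quotient `S² × ℝ/(log l₀)ℤ` and equivariant Arnold/Moffatt relaxation has exactly these cones as its
critical points (boundary fluxes of the first variation cancel iff `l₀^{3−2a} = 1`); engine:
Voigt–MHD relaxation, arXiv:2208.11109 Thm 1.1 (strong `L²` stationary Euler limits in `H^α`,
non-trivial for non-zero helicity). WHY IT MIGHT FAIL: relaxed limits are not known to be `C¹` or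
interacting; the nontriviality invariant must be a weighted helicity (plain helicity is invariant at
`a = 1`, not `3/2`); Shvydkoy's rigidity conjecture (arXiv:1510.03378 p.4) and "rotational asymmetric
homogeneous solutions: unknown" (arXiv:2305.05987 p.12). Leans on: `ContDiffOn`, `gradient`,
`Literature.Analysis.FluidPDE.convect`, `Literature.Analysis.FluidPDE.VectorCalculus.divergence`,
`Literature.Analysis.FluidPDE.IsOctahedralIsometry`.
[arXiv:2208.11109 Thm 1.1; arXiv:2305.05987 p.12; arXiv:1510.03378 p.4, Prop 5.1; ArnoldKhesin1998] -/
def stub_variational : Prop :=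
    ∃ (l₀ : ℝ) (h : EuclideanSpace ℝ (Fin 3) →
      EuclideanSpace ℝ (Fin 3)) (P : EuclideanSpace ℝ (Fin 3) → ℝ), 1 < l₀ ∧
      ContDiffOn ℝ 1 h {x : EuclideanSpace ℝ (Fin 3) | x ≠ 0} ∧
      ContDiffOn ℝ 1 P {x : EuclideanSpace ℝ (Fin 3) | x ≠ 0} ∧
      (∀ x : EuclideanSpace ℝ (Fin 3), x ≠ 0 → h (l₀ • x) = (l₀ ^ (-(3 / 2 : ℝ))) • h x) ∧
      (∀ x : EuclideanSpace ℝ (Fin 3), x ≠ 0 → P (l₀ • x) = l₀ ^ (-(3 : ℝ)) * P x) ∧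
      (∀ x : EuclideanSpace ℝ (Fin 3), x ≠ 0 →
      Literature.Analysis.FluidPDE.VectorCalculus.divergence h x = 0) ∧
      (∀ x : EuclideanSpace ℝ (Fin 3), x ≠ 0 →
      Literature.Analysis.FluidPDE.convect h h x + gradient P x = 0) ∧
      (∀ g : EuclideanSpace ℝ (Fin 3) ≃ₗᵢ[ℝ] EuclideanSpace ℝ (Fin 3), Literature.Analysis.FluidPDE.IsOctahedralIsometry g
      →
      LinearMap.det (g.toLinearEquiv : EuclideanSpace ℝ (Fin 3) →ₗ[ℝ] EuclideanSpace ℝ (Fin 3)) = 1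
      → ∀ x : EuclideanSpace ℝ (Fin 3), h (g x) = g (h x) ∧ P (g x) = P x) ∧
      (∀ s : Set (EuclideanSpace ℝ (Fin 3)), IsOpen s → s.Nonempty → ∃ x ∈ s, x ≠ 0 ∧ h x ≠ 0)

/-- **S2 `stub_continuation` — CONTINUATION IN THE EXPONENT.** Every critical cone as in S1
(`l₀ > 1`, `C¹` off the origin, DSS of degrees `(−3/2, −3)`, divergence-free steady Euler off the
origin, `O`-equivariant, interacting) continues to exponents just below the critical one: for every
`ε > 0` there are `a` with `3/2 − ε < a < 3/2`, a ratio `l₁ > 1` and a pair `(h₁, P₁)` satisfying the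
crux's clauses verbatim at `(a, l₁)` (`C¹` off `0`, `h₁(l₁ x) = l₁^{-a} h₁(x)`,
`P₁(l₁ x) = l₁^{-2a} P₁(x)`, `div h₁ = 0`, `(h₁·∇)h₁ + ∇P₁ = 0`, `O`-equivariant, interacting).
Size: L–XL (perturbative; CAP-certifiable). WHY PLAUSIBLE: on the compact quotient the exponent
enters the reduced first-order system only through zeroth-order terms (Euler's relations), so the
problem is analytic in `(a, l)`; at a critical cone non-degenerate modulo the two forced kernel
directions (amplitude scaling, dilation phase) the implicit function theorem in `O`-equivariant
`C^{1,β}` spaces — amplitude normalised, period `log l₁` freed — continues the cone to both sides of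
`3/2`. WHY IT MIGHT FAIL: degenerate critical cones (variational families), a fold at `a = 3/2` with
the branch only on `a ≥ 3/2`, and interaction is not `C¹`-open, so it must be certified along the
branch. Leans on: the same vocabulary as S1; precedents ChoffrutSverak2012 (GAFA 22; local structure of steady
states), Alber 1992 (perturbative 3-D steady flows). [ChoffrutSverak2012; Alber1992; route header
TWO-LAYER PLAN "continuation in a into (1,3/2), CAP"] -/
def stub_continuation : Prop :=
    ∀ (l₀ : ℝ) (h : EuclideanSpace ℝ (Fin 3) →
      EuclideanSpace ℝ (Fin 3)) (P : EuclideanSpace ℝ (Fin 3) → ℝ), 1 < l₀ →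
      (ContDiffOn ℝ 1 h {x : EuclideanSpace ℝ (Fin 3) | x ≠ 0} ∧
      ContDiffOn ℝ 1 P {x : EuclideanSpace ℝ (Fin 3) | x ≠ 0} ∧
      (∀ x : EuclideanSpace ℝ (Fin 3), x ≠ 0 → h (l₀ • x) = (l₀ ^ (-(3 / 2 : ℝ))) • h x) ∧
      (∀ x : EuclideanSpace ℝ (Fin 3), x ≠ 0 → P (l₀ • x) = l₀ ^ (-(3 : ℝ)) * P x) ∧
      (∀ x : EuclideanSpace ℝ (Fin 3), x ≠ 0 →
      Literature.Analysis.FluidPDE.VectorCalculus.divergence h x = 0) ∧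
      (∀ x : EuclideanSpace ℝ (Fin 3), x ≠ 0 →
      Literature.Analysis.FluidPDE.convect h h x + gradient P x = 0) ∧
      (∀ g : EuclideanSpace ℝ (Fin 3) ≃ₗᵢ[ℝ] EuclideanSpace ℝ (Fin 3), Literature.Analysis.FluidPDE.IsOctahedralIsometry g
      →
      LinearMap.det (g.toLinearEquiv : EuclideanSpace ℝ (Fin 3) →ₗ[ℝ] EuclideanSpace ℝ (Fin 3)) = 1
      → ∀ x : EuclideanSpace ℝ (Fin 3), h (g x) = g (h x) ∧ P (g x) = P x) ∧
      (∀ s : Set (EuclideanSpace ℝ (Fin 3)), IsOpen s → s.Nonempty → ∃ x ∈ s, x ≠ 0 ∧ h x ≠ 0)) →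
      ∀ ε : ℝ, 0 < ε → ∃ (a l₁ : ℝ) (h₁ : EuclideanSpace ℝ (Fin 3) →
      EuclideanSpace ℝ (Fin 3)) (P₁ : EuclideanSpace ℝ (Fin 3) → ℝ), 3 / 2 - ε < a ∧ a < 3 / 2 ∧
      1 < l₁ ∧ ContDiffOn ℝ 1 h₁ {x : EuclideanSpace ℝ (Fin 3) | x ≠ 0} ∧
      ContDiffOn ℝ 1 P₁ {x : EuclideanSpace ℝ (Fin 3) | x ≠ 0} ∧
      (∀ x : EuclideanSpace ℝ (Fin 3), x ≠ 0 → h₁ (l₁ • x) = (l₁ ^ (-a)) • h₁ x) ∧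
      (∀ x : EuclideanSpace ℝ (Fin 3), x ≠ 0 → P₁ (l₁ • x) = l₁ ^ (-(2 * a)) * P₁ x) ∧
      (∀ x : EuclideanSpace ℝ (Fin 3), x ≠ 0 →
      Literature.Analysis.FluidPDE.VectorCalculus.divergence h₁ x = 0) ∧
      (∀ x : EuclideanSpace ℝ (Fin 3), x ≠ 0 →
      Literature.Analysis.FluidPDE.convect h₁ h₁ x + gradient P₁ x = 0) ∧
      (∀ g : EuclideanSpace ℝ (Fin 3) ≃ₗᵢ[ℝ] EuclideanSpace ℝ (Fin 3), Literature.Analysis.FluidPDE.IsOctahedralIsometry g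
      →
      LinearMap.det (g.toLinearEquiv : EuclideanSpace ℝ (Fin 3) →ₗ[ℝ] EuclideanSpace ℝ (Fin 3)) = 1
      → ∀ x : EuclideanSpace ℝ (Fin 3), h₁ (g x) = g (h₁ x) ∧ P₁ (g x) = P₁ x) ∧
      (∀ s : Set (EuclideanSpace ℝ (Fin 3)), IsOpen s → s.Nonempty → ∃ x ∈ s, x ≠ 0 ∧ h₁ x ≠ 0)

end Statement

/-! ## The registered stubs S1–S2 (the only `sorry`s of the file) -/

/-- **S1 (registered stub): the energy-critical (`a = 3/2`) `O`-equivariant, interacting, `C¹` DSS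
steady Euler cone exists** — statement `Statement.stub_variational`. OPEN (the bet of the line). -/
theorem stub_variational : Statement.stub_variational := by
  sorry

/-- **S2 (registered stub): every critical cone continues to admissible cones with exponents just
below `3/2`** — statement `Statement.stub_continuation`. OPEN (perturbative; CAP-certifiable). -/
theorem stub_continuation : Statement.stub_continuation := by
  sorry

/-! ## The composition (kernel-checked, sorry-free): S1 → S2 → the crux, BY NAME -/

/-- **`InteractingLogPeriodicCone` from the two stub statements**: continue the energy-critical cone
of S1 with `ε = 1/2` (S2); the continued cone has `1 = 3/2 − 1/2 < a < 3/2` and carries every clause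
of the crux verbatim. The hypotheses are the stub statements BY NAME (`Statement.stub_variational`,
`Statement.stub_continuation`); the conclusion is literally the route decl. -/
theorem InteractingLogPeriodicCone_of :
    Statement.stub_variational → Statement.stub_continuation →
      Summit.NavierStokesRegularity.NavierStokesRegularity.Theses.ConeTipCollapse.InteractingLogPeriodicCone := by
  rintro ⟨l₀, h, P, hl₀, hcone⟩ hcont
  -- S2 (continuation) applied to the critical cone of S1 with `ε = 1/2`.
  obtain ⟨a, l₁, h₁, P₁, ha₁, ha₂, hl₁, hrest⟩ :=
    hcont l₀ h P hl₀ hcone (1 / 2) (by norm_num)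
  -- `3/2 − 1/2 < a` is `1 < a`; everything else is verbatim.
  exact ⟨a, l₁, h₁, P₁, by linarith, ha₂, hl₁, hrest⟩

/-- WIRING CHECK: the two sorried stubs compose to a closed term of the crux's type (modulo their
`sorry`s). Deliberately an `example` — no constant of type `InteractingLogPeriodicCone` enters the
environment. -/
example : Summit.NavierStokesRegularity.NavierStokesRegularity.Theses.ConeTipCollapse.InteractingLogPeriodicCone :=
  InteractingLogPeriodicCone_of stub_variational stub_continuation

end Summit.NavierStokesRegularity.NavierStokesRegularity.Cruxes.InteractingLogPeriodicCone.Birth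

end
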